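import Summits.Ventures.CertifiedManyBodySolver.Downfold.EmeryBoxesBi2223OPK14ThermalCapRetiltMarkovBoxp1
import Summits.Ventures.CertifiedManyBodySolver.Downfold.EmeryBoxesBi2223OPK14ThermalFloorAtlasWord
import Summits.Ventures.CertifiedManyBodySolver.Downfold.EmeryThermalAtomicFloor
import HarnessLib

/-!
# HIGH-TEMPERATURE-CLOSING `T > 0` WINDOW on Bi2Sr2Ca2Cu3O10 (M307 Bi-2223) OP plane Cu-OP — U-SLICE «(K) #14 Bi2212 static-cRPA CLASS  — `emeryBoxBi2223OPK14` (router/EMERY-FLOOR-ORDERS row 83): the ATOMIC-LIMIT floor (full entropy) ∨ the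
# family floor, against the re-tilted cap — both sides meet at `6 log 2` as β → 0

Venture CertifiedManyBodySolver, cell `pub/hubbard-downfold` (S1 = ROUTER) × crew hubbard-fast S2 (ii) × (iv) «T > 0 × multi-band» (D-0096 (ii)); seat hubbard-downfold-mod-4
(S1/S2 Emery seam, g17). Namespace `Summit.Ventures.CertifiedManyBodySolver.Downfold`. DOOR: `EmeryThermalAtomicFloor` (`holdsOn_emeryCellPressureAtomicFloor`: Peierls on the
whole occupation basis of the `Cu₄O₈` block, site-wise factorisation; the one-site function is the tree's `atomicPartitionFnReal β U μ`). INPUTS BY NAME: the family floor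
`emeryBoxBi2223OPK14_pressureFloorFam_m19o2` (`EmeryBoxesBi2223OPK14ThermalFloorAtlasWord`; C = (-144.162236, -144.710636)), the cap `emeryBoxBi2223OPK14_pressureCap_m19o2_retilt` (`EmeryBoxesBi2223OPK14ThermalCapRetiltMarkovBoxp1`; `6 log 2 + 40.6287·β`; flat word 43.8287).
ATOMIC DATA: Cu at `μ_d = −(εp + Δ_hi) = 152/25`, `U_d,hi = 997/200`; O at `μ_p = −εp = 19/2`, `U_p,hi = 573/125` ⇒ classical slope 36.0070·β (family slope 36.1777; cap 40.6287).
RESULT: **`emeryBoxBi2223OPK14_pressureWindowHighT_m19o2`**: `max(atomic, family) ≤ P_cell ≤ 6 log 2 + 40.6287·β` on the whole box, every β ≥ 0; width → 0 as β → 0 (both sides `6 log 2`,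
`emeryBoxBi2223OPK14_pressure_beta_zero_m19o2`); crossover β* ≈ 1.462 (T* ≈ 7940 K) below which the atomic floor is the better floor [float].

Everything PROVED (0 sorry); no definition. HONEST FRAMING: CERTIFIED inequalities on a SCREENING/EXTRAPOLATED-grade object; the atomic floor ignores hopping (its slope sits
0.1707 below the family floor's), so at physical temperatures (β ≈ 20–40 eV⁻¹) the family floor still decides and thermal scales are NOT resolved there; what is new
is the correct INFINITE-TEMPERATURE closure of the window and a certified high-T regime (β ≲ β*) with width `≈ 4.6217·β`; grand-canonical at the stated level; no phase word;
no router number moves. WHAT-THIS-IS-NOT: a new certificate (pure algebra on landed objects; zero kit).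
-/

noncomputable section

namespace Summit.Ventures.CertifiedManyBodySolver.Downfold

open NonemptyInterval Matrix Finset Literature.Probability.LatticeModels
open Literature.MathematicalPhysics.QuantumLattice Literature.Computation.Certificates
open Summit.Ventures.CertifiedManyBodySolver.Certificates OccupationCode ClusterLowerBound
open scoped BigOperators ComplexOrder

/-! ## §1 The atomic-limit floor on the box at εp = -19/2 -/

/-- **ATOMIC-LIMIT `T > 0` FLOOR** on the whole `emeryBoxBi2223OPK14`, cuprate signs, level εp = -19/2 (chemical potential 19/2 eV), EVERY β ≥ 0:
`log z₀(β; U_d = 997/200, μ_d = 152/25) + 2·log z₀(β; U_p = 573/125, μ_p = 19/2) ≤ P_cell` with `z₀(β; U, μ) = 1 + 2e^{βμ} + e^{−β(U−2μ)}` (`atomicPartitionFnReal`; Cu at the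
box's upper level `εp + Δ_hi = -152/25` and `U_d,hi`, O at `εp` and `U_p,hi`). Value `6 log 2` at β = 0; slope `36.0070·β` as β → ∞ (classical minimum, no hopping).
[cite: Ruelle1969, §2.5–2.6] [cite: Ueltschi1999, §3] -/
theorem emeryBoxBi2223OPK14_pressureAtomicFloor_m19o2 {β : ℝ} (hβ : 0 ≤ β) :
    HoldsOn (fun p : EmeryCoord → ℝ => Real.log (atomicPartitionFnReal β (997/200 : ℝ) (152/25 : ℝ)) + 2 * Real.log (atomicPartitionFnReal β (573/125 : ℝ) (19/2 : ℝ)) ≤ emeryCellPressure β (emeryLine cuprateSigns (emeryLineCoords (((-19/2 : ℚ)) : ℝ) p))) emeryBoxBi2223OPK14 := by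
  intro p hp
  have h := holdsOn_emeryCellPressureAtomicFloor (E := emeryBoxBi2223OPK14) (eA := bi2223OPK14Emery_tpd) (eB := bi2223OPK14Emery_tpp) (eD := bi2223OPK14Emery_Delta) (eUd := bi2223OPK14Emery_Udd) (eUp := bi2223OPK14Emery_Upp) (-19/2) (by simp [emeryBoxBi2223OPK14, emeryBoxBi2223OPK14Src, Function.update]) (by simp [emeryBoxBi2223OPK14, emeryBoxBi2223OPK14Src, Function.update]) (Function.update_self _ _ _) (by simp [emeryBoxBi2223OPK14, emeryBoxBi2223OPK14Src, Function.update]) (by simp [emeryBoxBi2223OPK14, emeryBoxBi2223OPK14Src, Function.update]) cuprateSigns hβ p hp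
  simp only [bi2223OPK14Emery_Delta, bi2223OPK14Emery_Udd, bi2223OPK14Emery_Upp, Entry.encl_ofEnds_snd] at h
  push_cast at h
  norm_num at h ⊢
  exact h

/-! ## §2 The best floor and the HIGH-TEMPERATURE-CLOSING window -/

/-- **BEST `T > 0` FLOOR = max(atomic, family)** on the whole box at εp = -19/2, every β ≥ 0: the atomic floor (full entropy, slope 36.0070) wins for
β < β* ≈ 1.462 (T > 7940 K), the family floor `emeryBoxBi2223OPK14_pressureFloorFam_m19o2` (slope 36.1777, entropy ¼·log 2) for β > β*. [cite: Ruelle1969, §2.5–2.6] [cite: Israel1979, Lemma II.3.1] -/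
theorem emeryBoxBi2223OPK14_pressureFloorBest_m19o2 {β : ℝ} (hβ : 0 ≤ β) :
    HoldsOn (fun p : EmeryCoord → ℝ => max (Real.log (atomicPartitionFnReal β (997/200 : ℝ) (152/25 : ℝ)) + 2 * Real.log (atomicPartitionFnReal β (573/125 : ℝ) (19/2 : ℝ))) (Real.log (Real.exp (-(β * (-36040559/250000 : ℝ))) + Real.exp (-(β * (-36177659/250000 : ℝ)))) / 4) ≤ emeryCellPressure β (emeryLine cuprateSigns (emeryLineCoords (((-19/2 : ℚ)) : ℝ) p))) emeryBoxBi2223OPK14 :=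
  fun p hp => max_le (emeryBoxBi2223OPK14_pressureAtomicFloor_m19o2 hβ p hp) (emeryBoxBi2223OPK14_pressureFloorFam_m19o2 hβ p hp)

/-- **THE HIGH-TEMPERATURE-CLOSING TWO-SIDED `T > 0` WINDOW** (hypothesis-free on both sides) on the whole `emeryBoxBi2223OPK14`, level εp = -19/2, EVERY β ≥ 0:
`max(atomic, family) ≤ P_cell ≤ 6 log 2 + β·1300119/32000` (cap = `emeryBoxBi2223OPK14_pressureCap_m19o2_retilt`, hubbard-box-p1 re-tilted). BOTH SIDES EQUAL `6 log 2` AT β = 0; the width is `O(β)` for small β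
(slope gap 4.6217 against the atomic floor, 4.4511 against the family floor). Table [float; `T = 11604.5/β` K]:
| β (1/eV) | T (K) | atomic floor | family floor | best floor | cap | width |
|---|---|---|---|---|---|---|
| 0.01 | 1160450 | 4.3774 | 0.5344 | 4.3774 | 4.5652 | 0.1878 |
| 0.1 | 116045 | 6.5889 | 3.7843 | 6.5889 | 8.2218 | 1.6329 |
| 0.5 | 23209 | 19.1022 | 18.2302 | 19.1022 | 24.4732 | 5.3710 |
| 1 | 11604 | 36.5488 | 36.2917 | 36.5488 | 44.7876 | 8.2388 |
| 2 | 5802 | 72.2162 | 72.4274 | 72.4274 | 85.4163 | 12.9890 |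
| 5 | 2321 | 180.0433 | 180.9039 | 180.9039 | 207.3025 | 26.3986 |
| 10 | 1160 | 360.0700 | 361.7776 | 361.7776 | 410.4461 | 48.6684 |
| 20 | 580 | 720.1400 | 723.5532 | 723.5532 | 816.7333 | 93.1801 |
| 40 | 290 | 1440.2800 | 1447.1064 | 1447.1064 | 1629.3076 | 182.2013 |
[cite: Israel1979, Thm. I.2.4] [cite: Ruelle1969, §2.5–2.6] [cite: Ueltschi1999, §3] -/
theorem emeryBoxBi2223OPK14_pressureWindowHighT_m19o2 {β : ℝ} (hβ : 0 ≤ β) :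
    HoldsOn (fun p : EmeryCoord → ℝ =>
      max (Real.log (atomicPartitionFnReal β (997/200 : ℝ) (152/25 : ℝ)) + 2 * Real.log (atomicPartitionFnReal β (573/125 : ℝ) (19/2 : ℝ))) (Real.log (Real.exp (-(β * (-36040559/250000 : ℝ))) + Real.exp (-(β * (-36177659/250000 : ℝ)))) / 4) ≤ emeryCellPressure β (emeryLine cuprateSigns (emeryLineCoords (((-19/2 : ℚ)) : ℝ) p)) ∧
      emeryCellPressure β (emeryLine cuprateSigns (emeryLineCoords (((-19/2 : ℚ)) : ℝ) p)) ≤ 6 * Real.log 2 + β * (1300119/32000 : ℝ)) emeryBoxBi2223OPK14 :=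
  fun p hp => ⟨emeryBoxBi2223OPK14_pressureFloorBest_m19o2 hβ p hp, by simpa using emeryBoxBi2223OPK14_pressureCap_m19o2_retilt hβ p hp⟩

/-- **At β = 0 the window is a point**: `P_cell(0, ·) = 6 log 2` on the whole box (floor and cap coincide). [cite: Ueltschi1999, §3] -/
theorem emeryBoxBi2223OPK14_pressure_beta_zero_m19o2 :
    HoldsOn (fun p : EmeryCoord → ℝ => emeryCellPressure 0 (emeryLine cuprateSigns (emeryLineCoords (((-19/2 : ℚ)) : ℝ) p)) = 6 * Real.log 2) emeryBoxBi2223OPK14 := by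
  intro p hp
  have h := emeryBoxBi2223OPK14_pressureWindowHighT_m19o2 le_rfl p hp
  rw [atomicPartitionFnReal_beta_zero, atomicPartitionFnReal_beta_zero, show (4 : ℝ) = 2 ^ 2 by norm_num, Real.log_pow] at h
  simp only [Nat.cast_ofNat, zero_mul, add_zero] at h
  have h1 := (le_max_left _ _).trans h.1
  linarith [h.2]

end Summit.Ventures.CertifiedManyBodySolver.Downfold

end
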